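import Mathlib
import HarnessLib

/-!
# The Terwilliger algebra of the binary Hamming scheme: orbits, dimension, block sizes

Topic `Literature/InformationTheory/Coding`. The combinatorial skeleton of Schrijver's semidefinite
programming bound for binary codes [Schrijver2005] as recalled by Laurent [Laurent2006, §2.1–§2.2,
pp. 244–246] and Gijswijt [Gijswijt2010, Ch. 3 §§1–2]: binary words of length `n` are identified
with
their supports `I ⊆ [n]` (`P = 2^[n]`, here `Finset (Fin n)`), and the symmetric group `Sym(n)` acts
by coordinate permutations (the stabiliser of the zero word in `Aut(P)`).

* `orbitTriple I J = (|I|, |J|, |I ∩ J|)` and **the orbit classification**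
  `exists_perm_map_eq_of_orbitTriple_eq` / `orbitTriple_map_perm`: two ordered pairs of words lie in
  the same `Sym(n)`-orbit iff they have the same triple [Laurent2006, §2.1 p. 244, the sentence
  before (9); Gijswijt2010, Ch. 3 §1 Prop. 11 (case `q = 2`)].
* `terwilligerIndex n = 𝓘(2,n) = {(i,j,t) : t ≤ i, t ≤ j, i + j ≤ n + t}` is exactly the set of
  realised triples (`image_orbitTriple_eq_terwilligerIndex`) and **`#𝓘(2,n) = C(n+3,3)`**
  (`card_terwilligerIndex`) — the dimension of the Terwilliger algebra
  `𝓐_n = span {M^t_{i,j}}` [Laurent2006, §2.2 p. 245 "dim 𝓐_n = C(n+3,3)"; Gijswijt2010, Ch. 3 §1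
  Prop. 10 and the display after Prop. 11; Schrijver2005].
* Schrijver's `0/1` matrices `orbitMatrix n (i,j,t) = M^t_{i,j}` [Laurent2006, (9)]: they partition
  the all-ones matrix (`sum_orbitMatrix`), have pairwise disjoint supports (`orbitMatrix_hadamard`),
  are nonzero exactly on `𝓘(2,n)` (`orbitMatrix_ne_zero_iff`), satisfy `(M^t_{i,j})ᵀ = M^t_{j,i}`
  (`orbitMatrix_transpose`) and are `Sym(n)`-invariant (`orbitMatrix_submatrix_perm`); the
  distance-`k` matrix of the Hamming scheme is `M_k = Σ_{i+j=k+2t} M^t_{i,j}`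
  (`hammingAdjacency_eq_sum_orbitMatrix`) [Laurent2006, (11) and the display after it;
  Gijswijt2010, Ch. 3 §1, the formula for `A_k`] — the Bose–Mesner algebra sits inside `𝓐_n`.
* The numerology of Schrijver's **block diagonalisation** [Laurent2006, §2.2 pp. 245–246 and
  Prop. 1; Gijswijt2010, Ch. 3 §2 Prop. 18; Schrijver2005]: block orders
  `blockSize n k = n + 1 - 2k` and multiplicities `blockMult n k = C(n,k) - C(n,k-1)`
  (`k = 0, …, ⌊n/2⌋`), both positive (`blockSize_pos`, `blockMult_pos`), with
  **`Σ_k (n+1-2k)² = C(n+3,3) = dim 𝓐_n`** (`sum_blockSize_sq`, the dimension count showing the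
  blocks fill the algebra) and **`Σ_k (n+1-2k)(C(n,k) - C(n,k-1)) = 2^n = |P|`**
  (`sum_blockSize_mul_blockMult`, Laurent's `|Q| = 2^n = |P|`).

Only this finite combinatorics is formalised here (no `C*`-algebra statement): it is what a
certificate checker needs to lay out the `C(n+3,3)` variables `x^t_{i,j}` and the `⌊n/2⌋ + 1`
blocks of Schrijver's SDP. All statements are over `ℕ` / `ℤ`.

References. [Schrijver2005] A. Schrijver, *New code upper bounds from the Terwilliger algebra and
semidefinite programming*, IEEE Trans. Inform. Theory 51 (2005) 2859–2866. [Laurent2006]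
M. Laurent, *Strengthened semidefinite programming bounds for codes*, Math. Program. 109 (2007)
239–261, §2.1 (eqs. (9)–(11)), §2.2 (pp. 245–246, Prop. 1). [Gijswijt2010] D. Gijswijt, *Matrix
algebras and semidefinite programming techniques for codes*, PhD thesis (Amsterdam 2005),
arXiv:1007.0906, Ch. 3 §1 (Prop. 10, 11, 12), §2 (Prop. 18) (proposition numbers as in the arXiv
version).
-/

open Finset

namespace Literature.InformationTheory.Coding

variable {n : ℕ}

/-! ## 1. The orbit invariant `(|I|, |J|, |I ∩ J|)` of a pair of subsets of `[n]` -/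

/-- The orbit invariant of an ordered pair of subsets of `[n]` (binary words of length `n` as
supports): `(|I|, |J|, |I ∩ J|)`.
[cite: Laurent2006, §2.1 p. 244 (orbits of pairs ⟷ (|I|,|J|,|I ∩ J|)); Gijswijt2010, Ch. 3 §1 Prop.
11 (q = 2)] -/
def orbitTriple (I J : Finset (Fin n)) : ℕ × ℕ × ℕ := (#I, #J, #(I ∩ J))

/-- [cite: Laurent2006, §2.1 p. 244 (orbits of pairs ⟷ (|I|,|J|,|I ∩ J|)); Gijswijt2010, Ch. 3 §1
Prop. 11 (q = 2)] -/
@[simp] theorem orbitTriple_fst (I J : Finset (Fin n)) : (orbitTriple I J).1 = #I := rfl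
/-- [cite: Laurent2006, §2.1 p. 244 (orbits of pairs ⟷ (|I|,|J|,|I ∩ J|)); Gijswijt2010, Ch. 3 §1
Prop. 11 (q = 2)] -/
@[simp] theorem orbitTriple_snd_fst (I J : Finset (Fin n)) : (orbitTriple I J).2.1 = #J := rfl
/-- [cite: Laurent2006, §2.1 p. 244 (orbits of pairs ⟷ (|I|,|J|,|I ∩ J|)); Gijswijt2010, Ch. 3 §1
Prop. 11 (q = 2)] -/
@[simp] theorem orbitTriple_snd_snd (I J : Finset (Fin n)) : (orbitTriple I J).2.2 = #(I ∩ J) := rfl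

/-- Invariance: a coordinate permutation `σ ∈ Sym(n)` does not change `(|I|, |J|, |I ∩ J|)`.
[cite: Laurent2006, §2.1 p. 244 (orbits of pairs ⟷ (|I|,|J|,|I ∩ J|)); Gijswijt2010, Ch. 3 §1 Prop.
11 (q = 2) (the easy direction: invariance)] -/
theorem orbitTriple_map_perm (σ : Equiv.Perm (Fin n)) (I J : Finset (Fin n)) :
    orbitTriple (I.map σ.toEmbedding) (J.map σ.toEmbedding) = orbitTriple I J := by
  simp only [orbitTriple, card_map, ← map_inter]

/-! ## 2. Permutations matching two maps with the same fibre cardinalities -/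

/-- If two maps `f g : α → β` on a finite type have fibres of the same cardinality over every point,
then `f = g ∘ σ` for a permutation `σ` of `α` (glue fibrewise bijections).
[cite: Gijswijt2010, Ch. 3 §1 Prop. 11 (proof device: glue fibrewise bijections into one
permutation)] -/
theorem exists_perm_comp_eq_of_card_fiber_eq {α β : Type*} [Fintype α] [DecidableEq α]
    [DecidableEq β] (f g : α → β)
    (h : ∀ b, #{a | f a = b} = #{a | g a = b}) :
    ∃ σ : Equiv.Perm α, ∀ a, g (σ a) = f a := by
  classical
  -- fibrewise equivalences
  have e : ∀ b, {a // f a = b} ≃ {a // g a = b} := fun b =>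
    Fintype.equivOfCardEq (by
      rw [Fintype.card_subtype, Fintype.card_subtype]; exact h b)
  let σ : α ≃ α :=
    (Equiv.sigmaFiberEquiv f).symm.trans ((Equiv.sigmaCongrRight e).trans (Equiv.sigmaFiberEquiv g))
  refine ⟨σ, fun a => ?_⟩
  have : σ a = ((e (f a)) ⟨a, rfl⟩ : α) := by
    simp [σ, Equiv.sigmaFiberEquiv, Equiv.sigmaCongrRight]
  rw [this]
  exact ((e (f a)) ⟨a, rfl⟩).2

/-- The `2`-bit position type of a coordinate with respect to a pair `(I, J)`.
[cite: Gijswijt2010, Ch. 3 §1 Prop. 11 (proof: the cells A, B, C of a pair)] -/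
def posType (I J : Finset (Fin n)) (x : Fin n) : Bool × Bool := (decide (x ∈ I), decide (x ∈ J))

/-- The four cells of the partition of `[n]` defined by a pair `(I, J)`.
[cite: Gijswijt2010, Ch. 3 §1 Prop. 11 (proof: the cells of a pair)] -/
def posCell (I J : Finset (Fin n)) : Bool × Bool → Finset (Fin n)
  | (true, true) => I ∩ J
  | (true, false) => I \ J
  | (false, true) => J \ I
  | (false, false) => (I ∪ J)ᶜ

/-- [cite: Gijswijt2010, Ch. 3 §1 Prop. 11 (proof)] -/
theorem filter_posType_eq_posCell (I J : Finset (Fin n)) (b : Bool × Bool) :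
    (univ.filter fun x => posType I J x = b) = posCell I J b := by
  obtain ⟨b₁, b₂⟩ := b
  ext x
  cases b₁ <;> cases b₂ <;> simp [posType, posCell, mem_sdiff, and_comm]

/-- The cardinalities of the four cells in terms of `(|I|, |J|, |I ∩ J|)` (and `n`).
[cite: Gijswijt2010, Ch. 3 §1 Prop. 11 (proof: cell sizes t, i − t, j − t, n − i − j + t)] -/
theorem card_posCell (I J : Finset (Fin n)) (b : Bool × Bool) :
    #(posCell I J b) =
      match b with
      | (true, true) => #(I ∩ J)
      | (true, false) => #I - #(I ∩ J)
      | (false, true) => #J - #(I ∩ J)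
      | (false, false) => n + #(I ∩ J) - #I - #J := by
  obtain ⟨b₁, b₂⟩ := b
  cases b₁ <;> cases b₂ <;> simp only [posCell]
  · rw [card_compl, Fintype.card_fin]
    have h2 : #(I ∩ J) ≤ #I := card_le_card inter_subset_left
    have h3 : #(I ∪ J) ≤ n := by simpa using card_le_univ (I ∪ J)
    have h4 := card_union_add_card_inter I J
    omega
  · have := card_sdiff_add_card_inter J I
    rw [inter_comm] at this
    omega
  · have := card_sdiff_add_card_inter I J
    omega

/-- The cell cardinalities only depend on `orbitTriple I J`.
[cite: Gijswijt2010, Ch. 3 §1 Prop. 11 (proof)] -/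
theorem card_filter_posType_eq_of_orbitTriple_eq {I J I' J' : Finset (Fin n)}
    (h : orbitTriple I J = orbitTriple I' J') (b : Bool × Bool) :
    #{x | posType I J x = b} = #{x | posType I' J' x = b} := by
  simp only [orbitTriple, Prod.mk.injEq] at h
  obtain ⟨h1, h2, h3⟩ := h
  rw [filter_posType_eq_posCell, filter_posType_eq_posCell, card_posCell, card_posCell]
  obtain ⟨b₁, b₂⟩ := b
  cases b₁ <;> cases b₂ <;> simp only [h1, h2, h3]

/-! ## 3. `Sym(n)` is transitive on the pairs with a given invariant -/

/-- **Orbit classification** (Laurent 2007 §2.1; Gijswijt 2005 Prop. 11 for `q = 2`): two ordered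
pairs of subsets of `[n]` with the same `(|I|, |J|, |I ∩ J|)` differ by a coordinate permutation.
[cite: Laurent2006, §2.1 p. 244 (orbits of pairs ⟷ (|I|,|J|,|I ∩ J|)); Gijswijt2010, Ch. 3 §1 Prop.
11 (q = 2) (the hard direction: transitivity)] -/
theorem exists_perm_map_eq_of_orbitTriple_eq {I J I' J' : Finset (Fin n)}
    (h : orbitTriple I J = orbitTriple I' J') :
    ∃ σ : Equiv.Perm (Fin n), I.map σ.toEmbedding = I' ∧ J.map σ.toEmbedding = J' := by
  obtain ⟨σ, hσ⟩ := exists_perm_comp_eq_of_card_fiber_eq (posType I J) (posType I' J')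
    (card_filter_posType_eq_of_orbitTriple_eq h)
  refine ⟨σ, ?_, ?_⟩
  · ext y
    have := congrArg Prod.fst (hσ (σ.symm y))
    simp only [Equiv.apply_symm_apply, posType, decide_eq_decide] at this
    rw [mem_map_equiv]
    exact this.symm
  · ext y
    have := congrArg Prod.snd (hσ (σ.symm y))
    simp only [Equiv.apply_symm_apply, posType, decide_eq_decide] at this
    rw [mem_map_equiv]
    exact this.symm

/-! ## 4. The index set `𝓘(2,n) = {(i,j,t) : t ≤ i, t ≤ j, i + j ≤ n + t}` and its cardinality -/

/-- The index set of the Terwilliger algebra of the binary Hamming scheme: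
`𝓘(2,n) = {(i, j, t) ∈ [0,n]³ : t ≤ i, t ≤ j, i + j ≤ n + t}`.
[cite: Laurent2006, §2.2 p. 245 (dim 𝓐_n = C(n+3,3)); Gijswijt2010, Ch. 3 §1 Prop. 10 (q = 2);
Schrijver2005 (the index set 𝓘(2,n))] -/
def terwilligerIndex (n : ℕ) : Finset (ℕ × ℕ × ℕ) :=
  (range (n + 1) ×ˢ (range (n + 1) ×ˢ range (n + 1))).filter
    fun p => p.2.2 ≤ p.1 ∧ p.2.2 ≤ p.2.1 ∧ p.1 + p.2.1 ≤ n + p.2.2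

/-- [cite: Laurent2006, §2.2 p. 245 (dim 𝓐_n = C(n+3,3)); Gijswijt2010, Ch. 3 §1 Prop. 10 (q = 2);
Schrijver2005] -/
theorem mem_terwilligerIndex {n i j t : ℕ} :
    (i, j, t) ∈ terwilligerIndex n ↔ t ≤ i ∧ t ≤ j ∧ i + j ≤ n + t ∧ i ≤ n ∧ j ≤ n := by
  simp only [terwilligerIndex, mem_filter, mem_product, mem_range]
  omega

/-- Pairs of naturals with bounded sum: `#{(a,b) : a + b ≤ m} = C(m+2, 2)`.
[cite: Gijswijt2010, Ch. 3 §1 Prop. 10 (proof: weak compositions, #{(a,b) : a + b ≤ m} = C(m+2,2))]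
-/
theorem card_filter_add_le (m : ℕ) :
    #((range (m + 1) ×ˢ range (m + 1)).filter fun p : ℕ × ℕ => p.1 + p.2 ≤ m) =
      (m + 2).choose 2 := by
  rw [card_filter, sum_product]
  have h : ∀ a ∈ range (m + 1),
      (∑ b ∈ range (m + 1), if a + b ≤ m then 1 else 0) = (m - a) + 1 := by
    intro a ha
    rw [mem_range] at ha
    rw [← card_filter]
    have : (range (m + 1)).filter (fun b => a + b ≤ m) = range (m - a + 1) := by
      ext b; simp only [mem_filter, mem_range]; omega
    rw [this, card_range]
  rw [sum_congr rfl h]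
  have h2 : ∑ a ∈ range (m + 1), (m - a + 1) = ∑ i ∈ range (m + 1), (i + 1) := by
    rw [← sum_range_reflect (fun i => i + 1) (m + 1)]
    refine sum_congr rfl fun a ha => ?_
    rw [mem_range] at ha
    congr 1
  rw [h2]
  have h3 := Nat.sum_range_add_choose m 1
  simp only [Nat.choose_one_right] at h3
  simpa using h3

/-- Triples of naturals with bounded sum: `#{(t,a,b) : t + a + b ≤ n} = C(n+3, 3)`
(weak compositions of `n` into four parts).
[cite: Gijswijt2010, Ch. 3 §1 Prop. 10 (proof: #{(t,a,b) : t + a + b ≤ n} = C(n+3,3))] -/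
theorem card_filter_add_add_le (n : ℕ) :
    #((range (n + 1) ×ˢ (range (n + 1) ×ˢ range (n + 1))).filter
        fun p : ℕ × ℕ × ℕ => p.1 + p.2.1 + p.2.2 ≤ n) = (n + 3).choose 3 := by
  rw [card_filter, sum_product]
  have h : ∀ t ∈ range (n + 1),
      (∑ q ∈ range (n + 1) ×ˢ range (n + 1), if t + q.1 + q.2 ≤ n then 1 else 0) =
        (n - t + 2).choose 2 := by
    intro t ht
    rw [mem_range] at ht
    rw [← card_filter, ← card_filter_add_le (n - t)]
    congr 1
    ext ⟨a, b⟩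
    simp only [mem_filter, mem_product, mem_range]
    omega
  rw [sum_congr rfl h]
  have h2 : ∑ t ∈ range (n + 1), (n - t + 2).choose 2 = ∑ i ∈ range (n + 1), (i + 2).choose 2 := by
    rw [← sum_range_reflect (fun i => (i + 2).choose 2) (n + 1)]
    refine sum_congr rfl fun a ha => ?_
    rw [mem_range] at ha
    congr 2
  rw [h2, Nat.sum_range_add_choose n 2]

/-- **Dimension of the Terwilliger algebra** of the binary Hamming scheme (Gijswijt 2005 Prop. 10
for `q = 2`; Laurent 2007 §2.2; Schrijver 2005): `|𝓘(2,n)| = C(n+3, 3)`.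
[cite: Laurent2006, §2.2 p. 245 (dim 𝓐_n = C(n+3,3)); Gijswijt2010, Ch. 3 §1 Prop. 10 (q = 2);
Schrijver2005] -/
theorem card_terwilligerIndex (n : ℕ) : #(terwilligerIndex n) = (n + 3).choose 3 := by
  rw [← card_filter_add_add_le n]
  refine card_nbij' (fun p => (p.2.2, p.1 - p.2.2, p.2.1 - p.2.2))
    (fun q => (q.1 + q.2.1, q.1 + q.2.2, q.1)) ?_ ?_ ?_ ?_
  · rintro ⟨i, j, t⟩ hp
    rw [mem_coe, mem_terwilligerIndex] at hp
    simp only [mem_coe, mem_filter, mem_product, mem_range]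
    omega
  · rintro ⟨t, a, b⟩ hq
    simp only [mem_coe, mem_filter, mem_product, mem_range] at hq
    rw [mem_coe, mem_terwilligerIndex]
    dsimp only
    omega
  · rintro ⟨i, j, t⟩ hp
    rw [mem_coe, mem_terwilligerIndex] at hp
    dsimp only
    simp only [Prod.mk.injEq, and_true]
    omega
  · rintro ⟨t, a, b⟩ hq
    simp only [mem_coe, mem_filter, mem_product, mem_range] at hq
    dsimp only
    simp only [Prod.mk.injEq, true_and]
    omega

/-! ## 5. Every index is realised, and only indices are realised -/

/-- The invariant of any pair lies in `𝓘(2,n)`.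
[cite: Laurent2006, §2.2 p. 245 (dim 𝓐_n = C(n+3,3)); Gijswijt2010, Ch. 3 §1 Prop. 10 (q = 2);
Schrijver2005 (every realised triple is an index)] -/
theorem orbitTriple_mem_terwilligerIndex (I J : Finset (Fin n)) :
    orbitTriple I J ∈ terwilligerIndex n := by
  rw [orbitTriple, mem_terwilligerIndex]
  have h1 : #(I ∩ J) ≤ #I := card_le_card inter_subset_left
  have h2 : #(I ∩ J) ≤ #J := card_le_card inter_subset_right
  have h3 : #(I ∪ J) ≤ n := by simpa using card_le_univ (I ∪ J)
  have h4 := card_union_add_card_inter I J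
  have h5 : #I ≤ n := by simpa using card_le_univ I
  have h6 : #J ≤ n := by simpa using card_le_univ J
  omega

/-- Transport of a `val`-defined filter on `Fin n` to a filter on `range n`.
[cite: Gijswijt2010, Ch. 3 §1 Prop. 10/11 (auxiliary transport Fin n → range n)] -/
theorem map_valEmbedding_filter (p : ℕ → Prop) [DecidablePred p] :
    (univ.filter fun x : Fin n => p x.val).map Fin.valEmbedding = (range n).filter p := by
  ext m
  simp only [mem_map, mem_filter, mem_univ, true_and, Fin.valEmbedding_apply, mem_range]
  constructor
  · rintro ⟨x, hx, rfl⟩; exact ⟨x.isLt, hx⟩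
  · rintro ⟨hm, hp⟩; exact ⟨⟨m, hm⟩, hp, rfl⟩

/-- [cite: Gijswijt2010, Ch. 3 §1 Prop. 10/11 (auxiliary)] -/
theorem card_filter_val (p : ℕ → Prop) [DecidablePred p] :
    #(univ.filter fun x : Fin n => p x.val) = #((range n).filter p) := by
  rw [← map_valEmbedding_filter p, card_map]

/-- Every `(i, j, t) ∈ 𝓘(2,n)` is the invariant of a pair: `I = [0, i)`, `J = [i - t, i - t + j)`.
[cite: Laurent2006, §2.2 p. 245 (dim 𝓐_n = C(n+3,3)); Gijswijt2010, Ch. 3 §1 Prop. 10 (q = 2);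
Schrijver2005 (every index is realised: Laurent's 'the number of triples (i,j,t) for which M^t_{i,j}
≠ 0')] -/
theorem exists_pair_of_mem_terwilligerIndex {i j t : ℕ} (h : (i, j, t) ∈ terwilligerIndex n) :
    ∃ I J : Finset (Fin n), orbitTriple I J = (i, j, t) := by
  rw [mem_terwilligerIndex] at h
  obtain ⟨hti, htj, hsum, hi, hj⟩ := h
  refine ⟨univ.filter fun x : Fin n => x.val < i,
    univ.filter fun x : Fin n => i - t ≤ x.val ∧ x.val < i - t + j, ?_⟩
  simp only [orbitTriple, Prod.mk.injEq]
  refine ⟨?_, ?_, ?_⟩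
  · rw [card_filter_val fun m => m < i]
    have : (range n).filter (fun m => m < i) = range i := by
      ext m; simp only [mem_filter, mem_range]; omega
    rw [this, card_range]
  · rw [card_filter_val fun m => i - t ≤ m ∧ m < i - t + j]
    have : (range n).filter (fun m => i - t ≤ m ∧ m < i - t + j) = Ico (i - t) (i - t + j) := by
      ext m; simp only [mem_filter, mem_range, mem_Ico]; omega
    rw [this, Nat.card_Ico]; omega
  · rw [← filter_and, card_filter_val fun m => m < i ∧ (i - t ≤ m ∧ m < i - t + j)]
    have : (range n).filter (fun m => m < i ∧ (i - t ≤ m ∧ m < i - t + j)) = Ico (i - t) i := by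
      ext m; simp only [mem_filter, mem_range, mem_Ico]; omega
    rw [this, Nat.card_Ico]; omega

/-- The set of realised invariants is exactly `𝓘(2,n)`.
[cite: Laurent2006, §2.2 p. 245 (dim 𝓐_n = C(n+3,3)); Gijswijt2010, Ch. 3 §1 Prop. 10 (q = 2);
Schrijver2005] -/
theorem image_orbitTriple_eq_terwilligerIndex (n : ℕ) :
    ((univ : Finset (Finset (Fin n) × Finset (Fin n))).image fun IJ => orbitTriple IJ.1 IJ.2) =
      terwilligerIndex n := by
  ext ⟨i, j, t⟩
  simp only [mem_image, mem_univ, true_and, Prod.exists]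
  constructor
  · rintro ⟨I, J, h⟩; rw [← h]; exact orbitTriple_mem_terwilligerIndex I J
  · intro h; exact exists_pair_of_mem_terwilligerIndex h

/-! ## 6. Schrijver's block structure: sizes `n + 1 - 2k`, multiplicities `C(n,k) - C(n,k-1)` -/

/-- The order `p_k = n + 1 - 2k` of the `k`-th block (`k = 0, …, ⌊n/2⌋`).
[cite: Laurent2006, §2.2 pp. 245–246 (p_k = n − 2k + 1, q_k = C(n,k) − C(n,k−1), |Q| = 2^n) and
Prop. 1; Gijswijt2010, Ch. 3 §2 Prop. 18; Schrijver2005] -/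
def blockSize (n k : ℕ) : ℕ := n + 1 - 2 * k

/-- The multiplicity `q_k = C(n,k) - C(n,k-1)` of the `k`-th block (with `C(n,-1) = 0`).
[cite: Laurent2006, §2.2 pp. 245–246 (p_k = n − 2k + 1, q_k = C(n,k) − C(n,k−1), |Q| = 2^n) and
Prop. 1; Gijswijt2010, Ch. 3 §2 Prop. 18; Schrijver2005] -/
def blockMult (n k : ℕ) : ℕ := if k = 0 then 1 else n.choose k - n.choose (k - 1)

/-- [cite: Laurent2006, §2.2 pp. 245–246 (p_k = n − 2k + 1, q_k = C(n,k) − C(n,k−1), |Q| = 2^n) and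
Prop. 1; Gijswijt2010, Ch. 3 §2 Prop. 18; Schrijver2005] -/
theorem blockSize_pos {n k : ℕ} (hk : k ≤ n / 2) : 0 < blockSize n k := by
  unfold blockSize; omega

/-- [cite: Laurent2006, §2.2 pp. 245–246 (p_k = n − 2k + 1, q_k = C(n,k) − C(n,k−1), |Q| = 2^n) and
Prop. 1; Gijswijt2010, Ch. 3 §2 Prop. 18; Schrijver2005 (auxiliary: C(n,k−1) ≤ C(n,k) for k ≤ n/2)]
-/
theorem choose_pred_le_choose {n k : ℕ} (hk : k ≤ n / 2) (hk0 : k ≠ 0) :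
    n.choose (k - 1) ≤ n.choose k := by
  have h := Nat.choose_le_succ_of_lt_half_left (r := k - 1) (n := n) (by omega)
  rwa [show k - 1 + 1 = k by omega] at h

/-- [cite: Laurent2006, §2.2 pp. 245–246 (p_k = n − 2k + 1, q_k = C(n,k) − C(n,k−1), |Q| = 2^n) and
Prop. 1; Gijswijt2010, Ch. 3 §2 Prop. 18; Schrijver2005 (auxiliary: C(n,k−1) < C(n,k) for 1 ≤ k ≤
n/2, so q_k ≥ 1)] -/
theorem choose_pred_lt_choose {n k : ℕ} (hk : k ≤ n / 2) (hk0 : k ≠ 0) :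
    n.choose (k - 1) < n.choose k := by
  -- `C(n,k) (k) = C(n,k-1) (n-k+1)` and `n - k + 1 > k`
  have h := Nat.choose_succ_right_eq n (k - 1)
  rw [show k - 1 + 1 = k by omega] at h
  have hpos : 0 < n.choose (k - 1) := Nat.choose_pos (by omega)
  by_contra hle
  rw [not_lt] at hle
  have : n.choose k * k ≤ n.choose (k - 1) * k := Nat.mul_le_mul_right k hle
  rw [h] at this
  have : n - (k - 1) ≤ k := Nat.le_of_mul_le_mul_left this hpos
  omega

/-- [cite: Laurent2006, §2.2 pp. 245–246 (p_k = n − 2k + 1, q_k = C(n,k) − C(n,k−1), |Q| = 2^n) and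
Prop. 1; Gijswijt2010, Ch. 3 §2 Prop. 18; Schrijver2005 (|B_k| = q_k ≥ 1)] -/
theorem blockMult_pos {n k : ℕ} (hk : k ≤ n / 2) : 0 < blockMult n k := by
  unfold blockMult
  split_ifs with h
  · exact one_pos
  · have := choose_pred_lt_choose hk h; omega

/-- Partial sums of the multiplicities telescope: `Σ_{k ≤ K} q_k = C(n,K)` for `K ≤ ⌊n/2⌋`.
[cite: Laurent2006, §2.2 pp. 245–246 (p_k = n − 2k + 1, q_k = C(n,k) − C(n,k−1), |Q| = 2^n) and
Prop. 1; Gijswijt2010, Ch. 3 §2 Prop. 18; Schrijver2005 (telescoping Σ_{k ≤ K} q_k = C(n,K))] -/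
theorem sum_blockMult (n : ℕ) {K : ℕ} (hK : K ≤ n / 2) :
    ∑ k ∈ range (K + 1), blockMult n k = n.choose K := by
  induction K with
  | zero => simp [blockMult]
  | succ K ih =>
    rw [sum_range_succ, ih (by omega), blockMult, if_neg (by omega), Nat.add_sub_cancel]
    have := choose_pred_le_choose (n := n) (k := K + 1) hK (by omega)
    rw [Nat.add_sub_cancel] at this
    omega

/-- [cite: Laurent2006, §2.2 pp. 245–246 (p_k = n − 2k + 1, q_k = C(n,k) − C(n,k−1), |Q| = 2^n) and
Prop. 1; Gijswijt2010, Ch. 3 §2 Prop. 18; Schrijver2005 (auxiliary binomial identity)] -/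
theorem choose_two_succ_add (m : ℕ) : (m + 1).choose 2 + m.choose 2 = m * m := by
  induction m with
  | zero => simp
  | succ m ih =>
    have h1 : (m + 2).choose 2 = (m + 1) + (m + 1).choose 2 := by
      rw [Nat.choose_succ_succ, Nat.choose_one_right]
    have h2 : (m + 1).choose 2 = m + m.choose 2 := by
      rw [Nat.choose_succ_succ, Nat.choose_one_right]
    rw [h1, h2]
    nlinarith [ih, h2]

/-- [cite: Laurent2006, §2.2 pp. 245–246 (p_k = n − 2k + 1, q_k = C(n,k) − C(n,k−1), |Q| = 2^n) and
Prop. 1; Gijswijt2010, Ch. 3 §2 Prop. 18; Schrijver2005 (auxiliary binomial identity)] -/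
theorem choose_three_step (n : ℕ) : (n + 5).choose 3 = (n + 3).choose 3 + (n + 3) * (n + 3) := by
  have h1 : (n + 5).choose 3 = (n + 4).choose 2 + (n + 4).choose 3 := Nat.choose_succ_succ _ _
  have h2 : (n + 4).choose 3 = (n + 3).choose 2 + (n + 3).choose 3 := Nat.choose_succ_succ _ _
  have h3 : (n + 4).choose 2 + (n + 3).choose 2 = (n + 3) * (n + 3) := choose_two_succ_add (n + 3)
  omega

/-- **Dimension check of the block diagonalisation** (Laurent 2007 §2.2; Gijswijt 2005 Prop. 18):
`Σ_{k=0}^{⌊n/2⌋} (n + 1 - 2k)² = C(n+3, 3) = dim 𝓐_n`.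
[cite: Laurent2006, §2.2 p. 245 (dim 𝓐_n = C(n+3,3) = Σ_k p_k²); Gijswijt2010, Ch. 3 §2 Prop. 18
(proof: dimension count); Schrijver2005] -/
theorem sum_blockSize_sq (n : ℕ) :
    ∑ k ∈ range (n / 2 + 1), blockSize n k ^ 2 = (n + 3).choose 3 := by
  induction n using Nat.twoStepInduction with
  | zero => simp [blockSize]
  | one => simp [blockSize]
  | more n ih _ =>
    rw [show (n + 2) / 2 + 1 = (n / 2 + 1) + 1 by omega, sum_range_succ', choose_three_step]
    have : ∀ k ∈ range (n / 2 + 1), blockSize (n + 2) (k + 1) ^ 2 = blockSize n k ^ 2 := by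
      intro k hk; unfold blockSize; congr 1; omega
    rw [sum_congr rfl this, ih]
    unfold blockSize
    simp only [Nat.mul_zero, Nat.sub_zero]
    ring

/-- `#{i ∈ [0,n] : k ≤ i ≤ n - k} = n + 1 - 2k`: the block of index `k` is indexed by these `i`.
[cite: Laurent2006, §2.2 pp. 245–246 (p_k = n − 2k + 1, q_k = C(n,k) − C(n,k−1), |Q| = 2^n) and
Prop. 1; Gijswijt2010, Ch. 3 §2 Prop. 18; Schrijver2005 (the rows of block k are indexed by k ≤ i ≤
n − k)] -/
theorem card_filter_le_le_sub {n k : ℕ} (hk : k ≤ n / 2) :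
    #((range (n + 1)).filter fun i => k ≤ i ∧ i ≤ n - k) = blockSize n k := by
  have : (range (n + 1)).filter (fun i => k ≤ i ∧ i ≤ n - k) = Icc k (n - k) := by
    ext i; simp only [mem_filter, mem_range, mem_Icc]; omega
  rw [this, Nat.card_Icc, blockSize]; omega

/-- **The blocks exhaust `2^n`** (Laurent 2007 §2.2 `Σ_k p_k q_k = 2^n = |P|`; Schrijver 2005):
`Σ_{k=0}^{⌊n/2⌋} (n + 1 - 2k) (C(n,k) - C(n,k-1)) = 2^n`.
[cite: Laurent2006, §2.2 p. 246 (|Q| = 2^n = |P|); Gijswijt2010, Ch. 3 §2 Prop. 18; Schrijver2005]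
-/
theorem sum_blockSize_mul_blockMult (n : ℕ) :
    ∑ k ∈ range (n / 2 + 1), blockSize n k * blockMult n k = 2 ^ n := by
  -- Step 1: `p_k = #{i : k ≤ i ≤ n-k}`, so the sum is `Σ_i Σ_{k ≤ min(i, n-i)} q_k`.
  have h1 : ∑ k ∈ range (n / 2 + 1), blockSize n k * blockMult n k =
      ∑ i ∈ range (n + 1), ∑ k ∈ range (n / 2 + 1),
        if k ≤ i ∧ i ≤ n - k then blockMult n k else 0 := by
    rw [sum_comm]
    refine sum_congr rfl fun k hk => ?_
    rw [mem_range] at hk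
    rw [← sum_filter, sum_const, card_filter_le_le_sub (by omega), smul_eq_mul]
  -- Step 2: the inner sum telescopes to `C(n, min(i, n-i))`.
  have h2 : ∀ i ∈ range (n + 1),
      (∑ k ∈ range (n / 2 + 1), if k ≤ i ∧ i ≤ n - k then blockMult n k else 0) =
        n.choose (min i (n - i)) := by
    intro i hi
    rw [mem_range] at hi
    have hm : min i (n - i) ≤ n / 2 := by omega
    rw [← sum_blockMult n hm, ← sum_filter]
    congr 1
    ext k; simp only [mem_filter, mem_range]; omega
  rw [h1, sum_congr rfl h2]
  -- Step 3: `C(n, min(i, n-i)) = C(n, i)` and `Σ_i C(n,i) = 2^n`.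
  have h3 : ∀ i ∈ range (n + 1), n.choose (min i (n - i)) = n.choose i := by
    intro i hi
    rw [mem_range] at hi
    rcases le_total i (n - i) with h | h
    · rw [min_eq_left h]
    · rw [min_eq_right h, Nat.choose_symm (by omega)]
  rw [sum_congr rfl h3, Nat.sum_range_choose]

/-! ## 7. The Bose–Mesner algebra inside the Terwilliger algebra -/

/-- `|I ∆ J| + 2 |I ∩ J| = |I| + |J|`: the Hamming distance of two words is `i + j - 2t`, so the
distance-`k` relation of the Hamming scheme is the union of the classes `(i, j, t)` with
`i + j = k + 2t` (Laurent 2007 (11)ff; Gijswijt 2005 Ch. 3 §1).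
[cite: Laurent2006, §2.1 eq. (11) and the display M_k = Σ_{i,j} M^{(i+j−k)/2}_{i,j}; Gijswijt2010,
Ch. 3 §1 (the formula for A_k) (|I ∆ J| = i + j − 2t)] -/
theorem card_symmDiff_add (I J : Finset (Fin n)) : #(symmDiff I J) + 2 * #(I ∩ J) = #I + #J := by
  rw [symmDiff_eq_sup_sdiff_inf, sup_eq_union, inf_eq_inter]
  have h0 := card_sdiff_add_card_eq_card (inter_subset_union : I ∩ J ⊆ I ∪ J)
  have h1 := card_union_add_card_inter I J
  omega

/-! ## 8. The matrices `M^t_{i,j}` and the Hamming-scheme adjacency matrices -/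

/-- Schrijver's `0/1` matrices `M^t_{i,j}` indexed by the subsets of `[n]` (binary words):
`(M_p)_{I,J} = [ (|I|, |J|, |I ∩ J|) = p ]`.
[cite: Laurent2006, §2.1 eq. (9) (the matrices M^t_{i,j}); Gijswijt2010, Ch. 3 §1 (M^{t,p}_{i,j}, q
= 2); Schrijver2005] -/
def orbitMatrix (n : ℕ) (p : ℕ × ℕ × ℕ) : Matrix (Finset (Fin n)) (Finset (Fin n)) ℤ :=
  fun I J => if orbitTriple I J = p then 1 else 0

/-- [cite: Laurent2006, §2.1 eq. (9) (the matrices M^t_{i,j}); Gijswijt2010, Ch. 3 §1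
(M^{t,p}_{i,j}, q = 2); Schrijver2005] -/
theorem orbitMatrix_apply (p : ℕ × ℕ × ℕ) (I J : Finset (Fin n)) :
    orbitMatrix n p I J = if orbitTriple I J = p then 1 else 0 := rfl

/-- The `M_p`, `p ∈ 𝓘(2,n)`, partition the all-ones matrix (their supports partition `P × P`).
[cite: Laurent2006, §2.1 eq. (9) (the matrices M^t_{i,j}); Gijswijt2010, Ch. 3 §1 (M^{t,p}_{i,j}, q
= 2); Schrijver2005 (the M^t_{i,j} partition J)] -/
theorem sum_orbitMatrix (n : ℕ) :
    ∑ p ∈ terwilligerIndex n, orbitMatrix n p = Matrix.of fun _ _ => 1 := by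
  ext I J
  rw [Matrix.sum_apply, Matrix.of_apply]
  simp only [orbitMatrix_apply, sum_ite_eq, if_pos (orbitTriple_mem_terwilligerIndex I J)]

/-- `M_p ≠ 0` exactly for `p ∈ 𝓘(2,n)` — so `{M_p}` has `C(n+3,3)` nonzero members with pairwise
disjoint supports.
[cite: Laurent2006, §2.2 p. 245 (dim 𝓐_n = C(n+3,3)); Gijswijt2010, Ch. 3 §1 Prop. 10 (q = 2);
Schrijver2005 (M^t_{i,j} ≠ 0 iff (i,j,t) ∈ 𝓘(2,n))] -/
theorem orbitMatrix_ne_zero_iff (p : ℕ × ℕ × ℕ) : orbitMatrix n p ≠ 0 ↔ p ∈ terwilligerIndex n := by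
  obtain ⟨i, j, t⟩ := p
  constructor
  · intro h
    by_contra hp
    apply h
    ext I J
    rw [orbitMatrix_apply, Matrix.zero_apply, if_neg]
    intro hIJ
    exact hp (hIJ ▸ orbitTriple_mem_terwilligerIndex I J)
  · intro hp h
    obtain ⟨I, J, hIJ⟩ := exists_pair_of_mem_terwilligerIndex hp
    have := congrFun (congrFun h I) J
    rw [orbitMatrix_apply, if_pos hIJ, Matrix.zero_apply] at this
    exact one_ne_zero this

/-- Disjoint supports: the entrywise (Hadamard) product of `M_p` and `M_q` vanishes for `p ≠ q`,
and `M_p ⊙ M_p = M_p`.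
[cite: Laurent2006, §2.1 eq. (9) (the matrices M^t_{i,j}); Gijswijt2010, Ch. 3 §1 (M^{t,p}_{i,j}, q
= 2); Schrijver2005 (disjoint supports)] -/
theorem orbitMatrix_hadamard (p q : ℕ × ℕ × ℕ) :
    Matrix.hadamard (orbitMatrix n p) (orbitMatrix n q) = if p = q then orbitMatrix n p else 0 := by
  ext I J
  simp only [Matrix.hadamard_apply]
  split_ifs with h
  · subst h
    rw [orbitMatrix_apply]
    split_ifs <;> simp
  · rw [Matrix.zero_apply, orbitMatrix_apply, orbitMatrix_apply]
    split_ifs with h1 h2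
    · exact absurd (h1.symm.trans h2) h
    all_goals simp

/-- Transposition swaps `i` and `j`: `(M^t_{i,j})ᵀ = M^t_{j,i}`.
[cite: Laurent2006, §2.1 eq. (9) (the matrices M^t_{i,j}); Gijswijt2010, Ch. 3 §1 (M^{t,p}_{i,j}, q
= 2); Schrijver2005 ((M^t_{i,j})ᵀ = M^t_{j,i}: 𝓐_n is closed under transposition)] -/
theorem orbitMatrix_transpose (i j t : ℕ) :
    (orbitMatrix n (i, j, t)).transpose = orbitMatrix n (j, i, t) := by
  ext I J
  simp only [Matrix.transpose_apply, orbitMatrix_apply, orbitTriple, Prod.mk.injEq, inter_comm]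
  by_cases h : #J = i ∧ #I = j ∧ #(I ∩ J) = t
  · rw [if_pos h, if_pos ⟨h.2.1, h.1, h.2.2⟩]
  · rw [if_neg h, if_neg (fun h' => h ⟨h'.2.1, h'.1, h'.2.2⟩)]

/-- Invariance: every `M_p` commutes with the coordinate permutations, i.e. lies in the commutant
of `Sym(n)` acting on `ℤ^P` (`M_p (σI, σJ) = M_p (I, J)`).
[cite: Laurent2006, §2.1 p. 244 (orbits of pairs ⟷ (|I|,|J|,|I ∩ J|)); Gijswijt2010, Ch. 3 §1 Prop.
11 (q = 2) (M^t_{i,j} lies in the commutant of Sym(n))] -/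
theorem orbitMatrix_submatrix_perm (σ : Equiv.Perm (Fin n)) (p : ℕ × ℕ × ℕ) :
    (orbitMatrix n p).submatrix (fun I => I.map σ.toEmbedding) (fun J => J.map σ.toEmbedding) =
      orbitMatrix n p := by
  ext I J
  simp only [Matrix.submatrix_apply, orbitMatrix_apply, orbitTriple_map_perm]

/-- The distance-`k` adjacency matrix of the binary Hamming scheme `H(n,2)` on `P = 2^[n]`
(Hamming distance = `|I ∆ J|`).
[cite: Laurent2006, §2.1 eq. (11) (the matrices M_k of the Bose–Mesner algebra)] -/
def hammingAdjacency (n k : ℕ) : Matrix (Finset (Fin n)) (Finset (Fin n)) ℤ :=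
  fun I J => if #(symmDiff I J) = k then 1 else 0

/-- **Bose–Mesner ⊆ Terwilliger** (Laurent 2007 §2.1: `M_k = Σ_{i,j} M^{(i+j-k)/2}_{i,j}`; Gijswijt
2005 Ch. 3 (the formula for `A_k`)): `A_k = Σ_{(i,j,t) ∈ 𝓘(2,n), i + j = k + 2t} M^t_{i,j}`.
[cite: Laurent2006, §2.1 eq. (11) and the display M_k = Σ_{i,j} M^{(i+j−k)/2}_{i,j}; Gijswijt2010,
Ch. 3 §1 (the formula for A_k)] -/
theorem hammingAdjacency_eq_sum_orbitMatrix (n k : ℕ) :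
    hammingAdjacency n k =
      ∑ p ∈ (terwilligerIndex n).filter (fun p => p.1 + p.2.1 = k + 2 * p.2.2),
        orbitMatrix n p := by
  ext I J
  rw [Matrix.sum_apply]
  simp only [hammingAdjacency, orbitMatrix_apply, sum_ite_eq, mem_filter,
    orbitTriple_mem_terwilligerIndex I J, true_and]
  simp only [orbitTriple]
  have h := card_symmDiff_add I J
  by_cases hk : #(symmDiff I J) = k
  · rw [if_pos hk, if_pos (by omega)]
  · rw [if_neg hk, if_neg (by omega)]

end Literature.InformationTheory.Coding
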